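import Summits.QuantumFields.YangMills.Theorems.LuscherReductionDressedRitzPolyakovLiftStaticsDressedSymmetry
import HarnessLib

/-!
# Line «polyakovlift» r3 on crux `DressedRitz` (stmt-QuantumFields-20205), stub S-STAT `stub_liftStatics` over the DRESSED family:
# the doublet lemma, clause (o2) for symmetry-separated pairs, the stub at levels `k ≤ 1`, and the exact residual — all in the r3 text

Fleet-service module of seat ym-infvol-p1 g5 (route `LuscherReduction`, femto rung R2b1).  Skeleton of record r3 `11209be61e7d2ff5`
(`STUB-KEY-r3.md` 8b07a52af953274a): `Stmt.stub_liftStatics = ∀ k, ∃ C ≥ 0, lam0 > 0, ∀ lam ∈ (0,lam0], ∃ L0, ∀ L ≥ L0, ∀ β, InFemtoWindow lam β L →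
∀ φ, IsRawVacuum β φ → ∀ ω g, LiftBasis (liftCoupling β L) k ω g → StaticClauses k C β (dressedLiftFamily β φ g)` (all objects the TREE's:
`…PolyakovLiftDefs` p523114, `…PolyakovLiftDressed` p529179).  With (o0) for the dressed family in the tree (`PolyakovLift.dressedLiftFamily_o0`,
lead, over this seat's `liftFamily_o0`) and the dressed covariance form `S₃`-invariant and bilinear (`…StaticsDressedSymmetry`):

* §1 ★ `l2_dressed_doublet_eq_zero_and_var_eq` — inside an `S₃`-doublet (some axis permutation rotates `(f₁,f₂)` by an angle with `sn ≠ 0`) the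
  dressed covariance matrix is EXACTLY scalar: `⟨u'_{f₁}, u'_{f₂}⟩ = 0`, `‖u'_{f₁}‖² = ‖u'_{f₂}‖²` (Schur `2×2` by hand);
* §2 `dressedLiftFamily_o2_of_symmetrySeparated`, `dressedLiftFamily_o2_of_doublet` — clause (o2) of the r3 text with ANY `C ≥ 0` for pairs of
  channels separated by `S₃` (invariant vs. zero-average) or forming a doublet;
* §3 ★ `dressed_stub_liftStatics_le_one` — the REGISTERED r3 STUB AT LEVELS `k ≤ 1` PROVED (`C = 0`); ★ `dressed_stub_liftStatics_of_o2` — the r3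
  stub follows from its (o2) conjunct alone (conclusion = body of `Stmt.stub_liftStatics` VERBATIM): the exact residual of S-STAT after the reshape.

WHAT REMAINS OPEN (located, unchanged in order by the dressing — lead HAZARD-S-LEAK-UV §«cost per clause»): (o2) for pairs of channels inside one
`S₃`-isotypic class at `k ≥ 2` — the `O(λ)` universality of the (time-`2m`) two-point function of flowed Polyakov eigen-ratio insertions in the femto
window; renormalised perturbation theory only in print [Luscher1983 §3, LuscherMunster1984 §2].  HONEST FRAMING: fixed-lattice bookkeeping and
exact symmetry on the CONDITIONAL femto rung R2b1; not the RG statement; nothing here bears on infinite volume, the continuum limit or the Clay gap.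
References: M. Lüscher, NPB 219 (1983) 233 [cite: Luscher1983, §2–§3]; M. Lüscher, U. Wolff, NPB 339 (1990) 222 [cite: LuscherWolff1990].
-/

set_option autoImplicit false

noncomputable section

open MeasureTheory Filter Topology
open Literature.MathematicalPhysics.QuantumFieldTheory
open Literature.MathematicalPhysics.QuantumLattice
open scoped BigOperators

namespace Summit.QuantumFields.YangMills.Theorems.FemtoTransferGap.PolyakovLift

open Summit.QuantumFields.YangMills.Theorems.FemtoTransferGap

/-! ## §1 ★ The dressed doublet lemma -/

section Doublet

variable {L : ℕ} [NeZero L]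

/-- ★ **DRESSED DOUBLET LEMMA**: for a raw vacuum `φ` and physical one-site `f₁, f₂` rotated by some axis permutation `c`
(`f₁∘P_c = cs f₁ + sn f₂`, `f₂∘P_c = −sn f₁ + cs f₂`, `cs² + sn² = 1`, `sn ≠ 0`), the dressed channel vectors satisfy `⟨u'_{f₁}, u'_{f₂}⟩ = 0` and
`‖u'_{f₁}‖² = ‖u'_{f₂}‖²`. [cite: Luscher1983, §2] [cite: LuscherWolff1990] -/
theorem l2_dressed_doublet_eq_zero_and_var_eq (β : ℝ) {φ : GaugeConfig 3 L SU2 → ℝ} (hφ : IsPhys φ)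
    (heig : transferApply β φ = levelValue su2Rep L β 0 • φ) {f₁ f₂ : GaugeConfig 3 1 SU2 → ℝ} (hf₁ : IsPhys f₁) (hf₂ : IsPhys f₂)
    (c : Equiv.Perm (Fin 3)) {cs sn : ℝ} (hrot : cs ^ 2 + sn ^ 2 = 1) (hsn : sn ≠ 0)
    (h₁ : (fun V => f₁ (configPerm c V)) = fun V => cs * f₁ V + sn * f₂ V)
    (h₂ : (fun V => f₂ (configPerm c V)) = fun V => -sn * f₁ V + cs * f₂ V) :
    l2 (dressedLiftVec β φ f₁) (dressedLiftVec β φ f₂) = 0 ∧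
      l2 (dressedLiftVec β φ f₁) (dressedLiftVec β φ f₁) = l2 (dressedLiftVec β φ f₂) (dressedLiftVec β φ f₂) := by
  have hrf : IsPhys fun V => cs * f₁ V + sn * f₂ V := by
    have : (fun V => cs * f₁ V + sn * f₂ V) = cs • f₁ + sn • f₂ := by funext V; simp [smul_eq_mul]
    rw [this]; exact (hf₁.smul cs).add (hf₂.smul sn)
  have hrg : IsPhys fun V => -sn * f₁ V + cs * f₂ V := by
    have : (fun V => -sn * f₁ V + cs * f₂ V) = (-sn) • f₁ + cs • f₂ := by funext V; simp [smul_eq_mul]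
    rw [this]; exact (hf₁.smul (-sn)).add (hf₂.smul cs)
  have e1 := (l2_dressedLiftVec_comp_configPerm β hφ heig c f₁ f₁).symm
  rw [h₁, l2_dressedLiftVec_lincomb_left β hφ cs sn hf₁ hf₂ hrf, l2_dressedLiftVec_lincomb_right β hφ cs sn hf₁ hf₂ hf₁,
    l2_dressedLiftVec_lincomb_right β hφ cs sn hf₁ hf₂ hf₂] at e1
  have e2 := (l2_dressedLiftVec_comp_configPerm β hφ heig c f₁ f₂).symm
  rw [h₁, h₂, l2_dressedLiftVec_lincomb_left β hφ cs sn hf₁ hf₂ hrg, l2_dressedLiftVec_lincomb_right β hφ (-sn) cs hf₁ hf₂ hf₁,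
    l2_dressedLiftVec_lincomb_right β hφ (-sn) cs hf₁ hf₂ hf₂] at e2
  rw [l2_comm (dressedLiftVec β φ f₂) (dressedLiftVec β φ f₁)] at e1 e2
  set A : ℝ := l2 (dressedLiftVec β φ f₁) (dressedLiftVec β φ f₁) with hA
  set B : ℝ := l2 (dressedLiftVec β φ f₁) (dressedLiftVec β φ f₂) with hB
  set D : ℝ := l2 (dressedLiftVec β φ f₂) (dressedLiftVec β φ f₂) with hD
  have h3 : sn * (sn * (A - D) - 2 * cs * B) = 0 := by linear_combination e1 + A * hrot
  have h4 : sn * (A - D) - 2 * cs * B = 0 := (mul_eq_zero.mp h3).resolve_left hsn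
  have h5 : sn * (2 * sn * B + cs * (A - D)) = 0 := by linear_combination e2 + B * hrot
  have h6 : 2 * sn * B + cs * (A - D) = 0 := (mul_eq_zero.mp h5).resolve_left hsn
  have hB0 : B = 0 := by
    have h7 : 2 * B * (sn ^ 2 + cs ^ 2) = 0 := by linear_combination sn * h6 - cs * h4
    have h8 : sn ^ 2 + cs ^ 2 = 1 := by linarith
    rw [h8, mul_one] at h7
    linarith
  have hAD : A = D := by
    have h9 : sn * (A - D) = 0 := by linear_combination h4 + 2 * cs * hB0
    have := (mul_eq_zero.mp h9).resolve_left hsn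
    linarith
  exact ⟨hB0, hAD⟩

end Doublet

/-! ## §2 Clause (o2) of the r3 text for symmetry-separated pairs and doublets -/

section Clause

variable {L : ℕ} [NeZero L]

/-- **(o2), dressed family, symmetry-separated pairs**: `S₃`-invariant channel vs. zero-average channel ⇒ `⟨u'_i, u'_l⟩ = 0`, so the (o2) inequality
holds with ANY `C ≥ 0`. [cite: Luscher1983, §2] -/
theorem dressedLiftFamily_o2_of_symmetrySeparated (β : ℝ) {φ : GaugeConfig 3 L SU2 → ℝ} (hvac : IsRawVacuum β φ)
    {B : ℝ} {k : ℕ} {ω : GaugeConfig 3 1 SU2 → ℝ} {g : Fin k → (GaugeConfig 3 1 SU2 → ℝ)} (hbasis : LiftBasis B k ω g)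
    {C : ℝ} (hC : 0 ≤ C) (i l : Fin k)
    (hsep : ((∀ π : Equiv.Perm (Fin 3), (fun V => g i (configPerm π V)) = g i) ∧
        (∀ V, ∑ π : Equiv.Perm (Fin 3), g l (configPerm π V) = 0)) ∨
      ((∀ π : Equiv.Perm (Fin 3), (fun V => g l (configPerm π V)) = g l) ∧
        (∀ V, ∑ π : Equiv.Perm (Fin 3), g i (configPerm π V) = 0))) :
    |l2 (dressedLiftFamily β φ g i) (dressedLiftFamily β φ g l)| ≤
      C * luscherLambda β L *
        (Real.sqrt (l2 (dressedLiftFamily β φ g i) (dressedLiftFamily β φ g i)) *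
          Real.sqrt (l2 (dressedLiftFamily β φ g l) (dressedLiftFamily β φ g l))) := by
  obtain ⟨hφ, -, heig⟩ := hvac
  have hg : ∀ j, IsPhys (g j) := hbasis.2.2.2.2.1
  have hzero : l2 (dressedLiftFamily β φ g i) (dressedLiftFamily β φ g l) = 0 := by
    show l2 (dressedLiftVec β φ (g i)) (dressedLiftVec β φ (g l)) = 0
    rcases hsep with ⟨hinv, havg⟩ | ⟨hinv, havg⟩
    · exact l2_dressedLiftVec_eq_zero_of_invariant β hφ heig (hg i) (hg l) hinv havg
    · rw [l2_comm]; exact l2_dressedLiftVec_eq_zero_of_invariant β hφ heig (hg l) (hg i) hinv havg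
  rw [hzero, abs_zero]
  exact mul_nonneg (mul_nonneg hC (KTRCalibration.luscherLambda_nonneg β L))
    (mul_nonneg (Real.sqrt_nonneg _) (Real.sqrt_nonneg _))

/-- **(o2), dressed family, doublets**: two channels forming a rotating doublet under some axis permutation ⇒ `⟨u'_i, u'_l⟩ = 0`, so the (o2)
inequality holds with ANY `C ≥ 0` — for every basis of the doublet. [cite: Luscher1983, §2] -/
theorem dressedLiftFamily_o2_of_doublet (β : ℝ) {φ : GaugeConfig 3 L SU2 → ℝ} (hvac : IsRawVacuum β φ)
    {B : ℝ} {k : ℕ} {ω : GaugeConfig 3 1 SU2 → ℝ} {g : Fin k → (GaugeConfig 3 1 SU2 → ℝ)} (hbasis : LiftBasis B k ω g)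
    {C : ℝ} (hC : 0 ≤ C) (i l : Fin k) (c : Equiv.Perm (Fin 3)) {cs sn : ℝ} (hrot : cs ^ 2 + sn ^ 2 = 1) (hsn : sn ≠ 0)
    (h₁ : (fun V => g i (configPerm c V)) = fun V => cs * g i V + sn * g l V)
    (h₂ : (fun V => g l (configPerm c V)) = fun V => -sn * g i V + cs * g l V) :
    |l2 (dressedLiftFamily β φ g i) (dressedLiftFamily β φ g l)| ≤
      C * luscherLambda β L *
        (Real.sqrt (l2 (dressedLiftFamily β φ g i) (dressedLiftFamily β φ g i)) *
          Real.sqrt (l2 (dressedLiftFamily β φ g l) (dressedLiftFamily β φ g l))) := by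
  obtain ⟨hφ, -, heig⟩ := hvac
  have hg : ∀ j, IsPhys (g j) := hbasis.2.2.2.2.1
  have hzero : l2 (dressedLiftFamily β φ g i) (dressedLiftFamily β φ g l) = 0 := by
    show l2 (dressedLiftVec β φ (g i)) (dressedLiftVec β φ (g l)) = 0
    exact (l2_dressed_doublet_eq_zero_and_var_eq β hφ heig (hg i) (hg l) c hrot hsn h₁ h₂).1
  rw [hzero, abs_zero]
  exact mul_nonneg (mul_nonneg hC (KTRCalibration.luscherLambda_nonneg β L))
    (mul_nonneg (Real.sqrt_nonneg _) (Real.sqrt_nonneg _))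

end Clause

/-! ## §3 ★ The r3 stub at levels `k ≤ 1`, and its exact residual -/

section Residual

/-- ★ **The registered r3 stub `stub_liftStatics` at levels `k ≤ 1` — PROVED, `C = 0`**: (o0) is the tree's `dressedLiftFamily_o0`, (o2) is
vacuous.  (Statement = body of r3's `Stmt.stub_liftStatics` restricted to `k ≤ 1`, all objects the tree's.) [cite: Luscher1983, §3] -/
theorem dressed_stub_liftStatics_le_one :
    ∀ k : ℕ, k ≤ 1 → ∃ C lam0 : ℝ, 0 ≤ C ∧ 0 < lam0 ∧ ∀ lam : ℝ, 0 < lam → lam ≤ lam0 → ∃ L0 : ℕ,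
      ∀ (L : ℕ) [NeZero L], L0 ≤ L → ∀ β : ℝ, InFemtoWindow lam β L →
        ∀ φ : GaugeConfig 3 L SU2 → ℝ, IsRawVacuum β φ →
          ∀ (ω : GaugeConfig 3 1 SU2 → ℝ) (g : Fin k → (GaugeConfig 3 1 SU2 → ℝ)), LiftBasis (liftCoupling β L) k ω g →
            StaticClauses k C β (dressedLiftFamily β φ g) := by
  intro k hk
  refine ⟨0, 1, le_rfl, one_pos, fun lam hlam _ => ⟨0, fun L _ _ β hW φ hvac ω g hbasis => ?_⟩⟩
  refine ⟨dressedLiftFamily_o0 hlam hW hvac hbasis, fun i l hil => ?_⟩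
  exfalso
  have : Subsingleton (Fin k) := by
    interval_cases k <;> infer_instance
  exact hil (Subsingleton.elim i l)

/-- ★ **THE EXACT RESIDUAL OF S-STAT (r3)**: the registered stub follows from its (o2) conjunct alone (conclusion = body of r3's
`Stmt.stub_liftStatics` VERBATIM; (o0) = `dressedLiftFamily_o0` for every `k`).  The hypothesis is what remains open: for `k ≥ 2`, pairs of channels
inside one `S₃`-isotypic class (other pairs: `dressedLiftFamily_o2_of_symmetrySeparated` ∕ `_of_doublet`). [cite: Luscher1983, §3] -/
theorem dressed_stub_liftStatics_of_o2
    (ho2 : ∀ k : ℕ, ∃ C lam0 : ℝ, 0 ≤ C ∧ 0 < lam0 ∧ ∀ lam : ℝ, 0 < lam → lam ≤ lam0 → ∃ L0 : ℕ,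
      ∀ (L : ℕ) [NeZero L], L0 ≤ L → ∀ β : ℝ, InFemtoWindow lam β L →
        ∀ φ : GaugeConfig 3 L SU2 → ℝ, IsRawVacuum β φ →
          ∀ (ω : GaugeConfig 3 1 SU2 → ℝ) (g : Fin k → (GaugeConfig 3 1 SU2 → ℝ)), LiftBasis (liftCoupling β L) k ω g →
            ∀ i l : Fin k, i ≠ l →
              |l2 (dressedLiftFamily β φ g i) (dressedLiftFamily β φ g l)| ≤ C * luscherLambda β L *
                (Real.sqrt (l2 (dressedLiftFamily β φ g i) (dressedLiftFamily β φ g i)) *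
                  Real.sqrt (l2 (dressedLiftFamily β φ g l) (dressedLiftFamily β φ g l)))) :
    ∀ k : ℕ, ∃ C lam0 : ℝ, 0 ≤ C ∧ 0 < lam0 ∧ ∀ lam : ℝ, 0 < lam → lam ≤ lam0 → ∃ L0 : ℕ,
      ∀ (L : ℕ) [NeZero L], L0 ≤ L → ∀ β : ℝ, InFemtoWindow lam β L →
        ∀ φ : GaugeConfig 3 L SU2 → ℝ, IsRawVacuum β φ →
          ∀ (ω : GaugeConfig 3 1 SU2 → ℝ) (g : Fin k → (GaugeConfig 3 1 SU2 → ℝ)), LiftBasis (liftCoupling β L) k ω g →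
            StaticClauses k C β (dressedLiftFamily β φ g) := by
  intro k
  obtain ⟨C, lam0, hC, hlam0, h⟩ := ho2 k
  refine ⟨C, lam0, hC, hlam0, fun lam hlam hle => ?_⟩
  obtain ⟨L0, hL0⟩ := h lam hlam hle
  exact ⟨L0, fun L _ hL β hW φ hvac ω g hbasis =>
    ⟨dressedLiftFamily_o0 hlam hW hvac hbasis, hL0 L hL β hW φ hvac ω g hbasis⟩⟩

end Residual

end Summit.QuantumFields.YangMills.Theorems.FemtoTransferGap.PolyakovLift

end
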